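import Summits.BirchSwinnertonDyer.BirchSwinnertonDyer.Theses.PrintX10b
import Summits.BirchSwinnertonDyer.BirchSwinnertonDyer.Theorems.PrintX10bHowardRoad
import Summits.BirchSwinnertonDyer.Rank1Residual.X10.CoreTheoremAOddPrimeHolds
import Literature.NumberTheory.EllipticCurves.Greenberg1999.RankZeroEulerCharacteristicOddPrimeProofs
import Literature.NumberTheory.EllipticCurves.SkinnerUrban2014.PAdicUnitPeriodRatioProofs
import HarnessLib

/-!
# Route `PrintX10b`: the ASSEMBLY CANDIDATE of the Howard road at `p = 3`, in the route's ITEM CURRENCY —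
# `HowardFrameSupplyX10b → (MZ26 Cor 4.6) → (YZ/BCS/CGLS composite) → AnalyticMuZeroX10b →
# HeegnerPrintFactsX10b → PrintFactsX10b → X10.BSDpOnClassX10b` — NO `HeegnerDivisibilityX10b` (J₃)
# (cell `bsd-print-x9`, prover seat p4, gen 3; the `p = 3` twin of `PrintX9HowardAssembly.lean`)

HONEST FRAMING (cell `run/shared/lean/pub/bsd-print-x9/`, D-0131 print tier): THEOREMS ONLY, nothing
booked, the leaf is NOT closed. Route PrintX10b's proved `AssemblyHeegner` (21207) reads
`HeegnerDivisibilityX10b (J₃) → AnalyticMuZeroX10b → HeegnerPrintFactsX10b → PrintFactsX10b →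
X10.BSDpOnClassX10b`; J₃'s open residual after p3 g2's Jetchev twin at 3 is `BeyondCarrierDepthX10b`
(ALL 39 rank-one X10b census pairs; no print at any image). This file states, with every EXISTING item
BY NAME and the three not-yet-items spelled out, the alternative assembly that the Howard road at 3
proves (`PrintX10bHowardRoad.lean`): J₃ ↦ a Heegner FRAME with `3 ∤ h_K` and `L(E^{d_K},1) ≠ 0` on the
non-CM rank-one X10b pairs (`hFS3`; per pair a finite certificate — ty3 g4's Howard frames —,
class-wide beyond print), through Mastella–Zerman 2026 Cor. 4.6 at `p = 3` (`h46`, printed for every odd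
`p`) and the Yan–Zhu 5.7 (1)/5.9 + BCS 4.2.2 + CGLS 5.1.3 composite (`hYZ`, flags
`YZ26-57i+59+BCS422+CGLS513-composite`, `YZ26@3-BF-ERL-Ohta`). The engine (Kato fine quotient + Yan–Zhu
Thm. 4.9 + Mazur periods + `μ_an = 0`, `X10.mazurMainConjectureOnClassX10b_of_fine`) and Greenberg's
rank-`0` value (Schneider 1985 + Mazur–Tate `σ`) are read on the bundles exactly as in p1's
`printX10b_assemblyHeegner_proof`. If the planner files the three binders as items and re-glues the
assembly, the new assembly is this theorem by one `exact`.

References: [MastellaZerman2026] Cor. 4.6; [YanZhu2024MainConjNonCM] Thm. 4.9, 5.7 (1), 5.9;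
[BurungaleCastellaSkinner2025] Prop. 4.2.2; [CastellaGrossiLeeSkinner2022] Thm. 5.1.3;
[JetchevSkinnerWan2017] Thm. 3.3.1; [Kato2004Asterisque] Thm. 12.6, §17.13; [GreenbergLNM1716]
Thm. 4.1; [Schneider1985] Thm. 2'; route file `Theses/PrintX10b.lean`.
-/

set_option autoImplicit false
set_option linter.dupNamespace false

noncomputable section

namespace Summit.BirchSwinnertonDyer.Rank1Residual.X10

open Literature.NumberTheory.EllipticCurves Literature.NumberTheory.EllipticCurves.SkinnerUrban2014
open Summit.BirchSwinnertonDyer.BirchSwinnertonDyer.Theses.PrintX10b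

/-- **The Howard-road assembly of route `PrintX10b` in item currency** (`p = 3`): from the FRAME
SUPPLY on the non-CM rank-one X10b pairs (`hFS3`), Mastella–Zerman 2026 Cor. 4.6 (`h46`), the
Yan–Zhu/BCS/CGLS composite (`hYZ`), and the route's items BY NAME — `AnalyticMuZeroX10b` (20682),
`HeegnerPrintFactsX10b` (21206), `PrintFactsX10b` (20684) — the leaf `X10.BSDpOnClassX10b`. One `exact`
onto `X10.bsdpOnClassX10b_of_mazurMainConjectureOnClassX10b_of_howardFrameSupply` after destructuring the
two bundles (as in `printX10b_assemblyHeegner_proof`), with the engine `mazurMainConjectureOnClassX10b_of_fine`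
and Greenberg's rank-`0` value from Schneider 1985. CONDITIONAL; nothing booked;
`HeegnerDivisibilityX10b` (21340) is NOT used. [cite: MastellaZerman2026, Cor. 4.6]
[cite: YanZhu2024MainConjNonCM, Thm. 4.9 (§4.4), Thm. 5.7 (1), Thm. 5.9]
[cite: Kato2004Asterisque, Thm. 12.6 (p. 222) and §17.13 (pp. 279–280)]
[cite: GreenbergLNM1716, Thm. 4.1 (p. 102)] [cite: Schneider1985, Thm. 2'] [cite: Miller2011LMS, §1 and Def. 1.1] -/
theorem howardAssemblyThree_of_howardFrameSupply
    (hFS3 : ∀ (W : WeierstrassCurve ℚ) [W.IsElliptic] [W.IsGloballyMinimal] [NeZero (W.conductorNorm ℤ)]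
      (p : ℕ) [Fact p.Prime], Literature.NumberTheory.EllipticCurves.Rank1Residual.ClassX10 W p →
      ¬ Literature.NumberTheory.EllipticCurves.Rank1Residual.Surj W 3 → ¬ W.HasCM → W.analyticRank = 1 →
      ∃ (K : Type) (_ : Field K) (_ : NumberField K), IsImaginaryQuadratic K ∧
        Odd (NumberField.discr K) ∧ NumberField.discr K < -4 ∧
        SatisfiesHeegnerHypothesis (W.conductorNorm ℤ) K ∧ SatisfiesHeegnerHypothesis p K ∧
        ¬ p ∣ NumberField.classNumber K ∧
        (W.quadraticTwist (NumberField.discr K : ℚ)).entireLFunction 1 ≠ 0)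
    (h46 : MastellaZerman2026.cor46_howardDivisibility_of_scalarImage.{0})
    (hYZ : YanZhu2026.thm57_thm59_bcs422_cgls513_generator_constantCoeff_of_heegnerDivisibility) :
    AnalyticMuZeroX10b → HeegnerPrintFactsX10b → PrintFactsX10b →
    Summit.BirchSwinnertonDyer.Rank1Residual.X10.BSDpOnClassX10b := by
  intro hA hHP hP
  obtain ⟨hGZ, hKo, -, -, -, -, -, h331, hmod, hnf, -, hNS, hCM, hLLT, hKob⟩ := hHP
  obtain ⟨hYZ49, hM, hS, -, hmodP, hGZK, hfine⟩ := hP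
  exact Summit.BirchSwinnertonDyer.BirchSwinnertonDyer.Rank1Residual.X10.bsdpOnClassX10b_of_mazurMainConjectureOnClassX10b_of_howardFrameSupply
    h46 hYZ h331 hGZ hKo
    (greenberg_charValue_rankZero_of_Schneider1985_odd hS mazur_tate_sigma_exists_odd_holds)
    hGZK hmod hmodP hnf hM hNS hCM hLLT hKob
    (mazurMainConjectureOnClassX10b_of_fine hYZ49 (realPeriodRat_eq_unit_mul_plusPeriod_of_mazur hM)
      (realPeriodRat_eq_unit_mul_plusPeriod_three_of_mazur hM) hmodP hfine hA)
    hFS3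

end Summit.BirchSwinnertonDyer.Rank1Residual.X10

end
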